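import Summits.CriticalPhenomena.Ising3DConformalLimit.Theorems.EnergyNotSigmaSquaredRungOneAdjacentMergingDefs
import Mathlib.Analysis.SpecificLimits.Basic
import HarnessLib

/-!
# Abstract share harvest, part 1: divergence of the windowed shares
(stub `stub_abstractHarvest` of the line `dominant-shell-concentration`, crux `RungOneAdjacentMerging`,
item stmt-CriticalPhenomena-11262; lead prover-line-stmt-CriticalPhenomena-11262-0)

For real sequences `a, B` with `HarvestData a B` (Defs file) write `sh k = 8^k a(k+2)²/B(k+1)` (the
share of the dyadic scale `k`) and call `k` WINDOWED (constant `A`) when `a(k-4) ≤ A·a(k+4)`.  This file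
proves, with `A = 2^128`:

* basic consequences of the shell sandwich: `sh k ≤ 1/7` (`k ≥ 1`), `B(k+1) ≤ 1391·B k` (`k ≥ 3`);
* DIVERGENCE OF THE SHARES `Σ_k sh k = ∞` (Abel–Dini on `B → ∞`: the relative bubble increment
  `(B(k+3)-B(k+2))/B(k+3)` is at most `9728·sh k`), in the finitary form
  `∀ m ≥ 1, ∀ M, ∃ n, M ≤ Σ_{k∈[m,n)} sh k`;
* the ANCESTOR LEMMA: a non-windowed scale `k ≥ 6` has `sh k ≤ (1/32)·sh k'` for some
  `k' ∈ [k-6, k-1]` — a drop `a j > 2^16 a(j+1)` at some `j ∈ [k-4, k+1]` is seen by `a(k+2)` directly,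
  and at `j ∈ {k+2, k+3}` it forces `a(k+1) > 16·a(k+2)` by the dyadic log-convexity
  `a(j+1)³ ≤ a(j)²a(j+2)`;
* DIVERGENCE OF THE WINDOWED SHARES: `∀ m ≥ 1, ∀ M, ∃ n, M ≤ Σ_{k∈[m,n), k windowed} sh k`.

Everything is elementary real analysis on the nine fields of `HarvestData`; no lattice object occurs.
All statements take the share function `sh` as an argument together with its defining equation, so that
no definition is introduced.
-/

noncomputable section

open Finset Filter
open scoped BigOperators

namespace Summit.CriticalPhenomena.Ising3DConformalLimit.RungOneAdjacentMergingDominantShell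

variable {a B : ℕ → ℝ}

/-! ### Basic consequences of `HarvestData` -/

/-- `B k > 0` for every `k`. [folklore] -/
theorem harvest_B_pos (h : HarvestData a B) (k : ℕ) : 0 < B k :=
  lt_of_lt_of_le h.B_pos (h.B_mono (Nat.zero_le k))

/-- `B k ≥ 7·8^k a(k+2)² + B(k-1)` hence `7·8^k·a(k+2)² < B k` for `k ≥ 1`. [folklore] -/
theorem harvest_seven_mul_lt_B (h : HarvestData a B) {k : ℕ} (hk : 1 ≤ k) :
    7 * 8 ^ k * a (k + 2) ^ 2 < B k := by
  have h1 := h.shell_lower k hk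
  have h2 := harvest_B_pos h (k - 1)
  linarith

/-- The share bound `sh k ≤ 1/7` for `k ≥ 1`. [folklore] -/
theorem harvest_share_le (h : HarvestData a B) {sh : ℕ → ℝ}
    (hsh : ∀ k, sh k = 8 ^ k * a (k + 2) ^ 2 / B (k + 1)) {k : ℕ} (hk : 1 ≤ k) : sh k ≤ 1 / 7 := by
  rw [hsh, div_le_iff₀ (harvest_B_pos h _)]
  have h1 := harvest_seven_mul_lt_B h hk
  have h2 : B k ≤ B (k + 1) := h.B_mono (Nat.le_succ k)
  linarith

/-- Shares are nonnegative. [folklore] -/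
theorem harvest_share_nonneg (h : HarvestData a B) {sh : ℕ → ℝ}
    (hsh : ∀ k, sh k = 8 ^ k * a (k + 2) ^ 2 / B (k + 1)) (k : ℕ) : 0 ≤ sh k := by
  rw [hsh]
  exact div_nonneg (mul_nonneg (pow_nonneg (by norm_num) _) (sq_nonneg _)) (harvest_B_pos h _).le

/-- Bubble doubling at the dyadic level: `B(k+1) ≤ 1391·B k` for `k ≥ 3` (the shell `k+1` is bounded by
`19·8^{k+1} a(k)²` and the shell `k-2` from below by `7·8^{k-2} a(k)²`). [folklore] -/
theorem harvest_B_succ_le (h : HarvestData a B) {k : ℕ} (hk : 3 ≤ k) : B (k + 1) ≤ 1391 * B k := by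
  have hu := h.shell_upper (k + 1) (by omega)
  simp only [Nat.add_sub_cancel] at hu
  have hl := h.shell_lower (k - 2) (by omega)
  have hk2 : k - 2 + 2 = k := by omega
  rw [hk2] at hl
  have hB3 := harvest_B_pos h (k - 2 - 1)
  have hmono : B (k - 2) ≤ B k := h.B_mono (by omega)
  have h8 : (8 : ℝ) ^ (k + 1) = 512 * 8 ^ (k - 2) := by
    rw [show k + 1 = (k - 2) + 3 by omega, pow_add]; ring
  rw [h8] at hu
  have hX : 8 ^ (k - 2) * a k ^ 2 < B k / 7 := by
    rw [lt_div_iff₀ (by norm_num : (0:ℝ) < 7)]; linarith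
  have hX' : 19 * (512 * (8 : ℝ) ^ (k - 2)) * a k ^ 2 = 9728 * (8 ^ (k - 2) * a k ^ 2) := by ring
  rw [hX'] at hu
  have hBk := harvest_B_pos h k
  linarith

/-! ### Divergence of the shares (Abel–Dini) -/

/-- The relative bubble increment three scales up is controlled by the share:
`(B(k+3) - B(k+2))/B(k+3) ≤ 9728·sh k` for `k ≥ 1`. [folklore] -/
theorem harvest_increment_le_share (h : HarvestData a B) {sh : ℕ → ℝ}
    (hsh : ∀ k, sh k = 8 ^ k * a (k + 2) ^ 2 / B (k + 1)) (k : ℕ) :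
    (B (k + 3) - B (k + 2)) / B (k + 3) ≤ 9728 * sh k := by
  have hu := h.shell_upper (k + 3) (by omega)
  simp only [show k + 3 - 1 = k + 2 by omega] at hu
  have hB3 := harvest_B_pos h (k + 3)
  have hB1 := harvest_B_pos h (k + 1)
  have hmono : B (k + 1) ≤ B (k + 3) := h.B_mono (by omega)
  rw [hsh, div_le_iff₀ hB3]
  have h8 : (8 : ℝ) ^ (k + 3) = 512 * 8 ^ k := by rw [pow_add]; ring
  rw [h8] at hu
  have ha : 0 ≤ (8 : ℝ) ^ k * a (k + 2) ^ 2 := mul_nonneg (pow_nonneg (by norm_num) _) (sq_nonneg _)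
  have key : 8 ^ k * a (k + 2) ^ 2 / B (k + 1) * B (k + 3) ≥ 8 ^ k * a (k + 2) ^ 2 := by
    rw [div_mul_eq_mul_div, ge_iff_le, le_div_iff₀ hB1]
    exact mul_le_mul_of_nonneg_left hmono ha
  linarith

/-- Telescoping lower bound for the relative increments (Abel–Dini):
`Σ_{k∈[m,n)} (B(k+3)-B(k+2))/B(k+3) ≥ (B(n+2) - B(m+2))/B(n+2)` for `m ≤ n`. [folklore] -/
theorem harvest_sum_increment_ge (h : HarvestData a B) {m n : ℕ} (hmn : m ≤ n) :
    (B (n + 2) - B (m + 2)) / B (n + 2) ≤ ∑ k ∈ Ico m n, (B (k + 3) - B (k + 2)) / B (k + 3) := by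
  have hBn := harvest_B_pos h (n + 2)
  have hterm : ∀ k ∈ Ico m n, (B (k + 3) - B (k + 2)) / B (n + 2) ≤ (B (k + 3) - B (k + 2)) / B (k + 3) := by
    intro k hk
    rw [Finset.mem_Ico] at hk
    have hnum : 0 ≤ B (k + 3) - B (k + 2) := sub_nonneg.2 (h.B_mono (Nat.le_succ _))
    exact div_le_div_of_nonneg_left hnum (harvest_B_pos h _) (h.B_mono (by omega))
  refine le_trans ?_ (Finset.sum_le_sum hterm)
  rw [← Finset.sum_div]
  refine div_le_div_of_nonneg_right (le_of_eq ?_) hBn.le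
  -- telescoping
  have htel : ∀ n, m ≤ n → ∑ k ∈ Ico m n, (B (k + 3) - B (k + 2)) = B (n + 2) - B (m + 2) := by
    intro n hn
    induction n, hn using Nat.le_induction with
    | base => simp
    | succ n hn ih =>
        rw [Finset.sum_Ico_succ_top hn, ih]
        ring
  exact (htel n hmn).symm

/-- One harvesting round: from any `m`, some `n > m` has `Σ_{k∈[m,n)} sh k ≥ 1/19456` (because `B → ∞`).
[folklore] -/
theorem harvest_round (h : HarvestData a B) {sh : ℕ → ℝ}
    (hsh : ∀ k, sh k = 8 ^ k * a (k + 2) ^ 2 / B (k + 1)) (m : ℕ) :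
    ∃ n, m < n ∧ 1 / 19456 ≤ ∑ k ∈ Ico m n, sh k := by
  -- choose n with B(n+2) ≥ 2 B(m+2)
  have hev := (h.B_tendsto.eventually_ge_atTop (2 * B (m + 2)))
  rw [Filter.eventually_atTop] at hev
  obtain ⟨N, hN⟩ := hev
  refine ⟨max N (m + 1), by omega, ?_⟩
  set n := max N (m + 1) with hn
  have hBn2 : 2 * B (m + 2) ≤ B (n + 2) := hN (n + 2) (by omega)
  have hBm := harvest_B_pos h (m + 2)
  have hBn := harvest_B_pos h (n + 2)
  have hAD := harvest_sum_increment_ge h (show m ≤ n by omega)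
  have hhalf : 1 / 2 ≤ (B (n + 2) - B (m + 2)) / B (n + 2) := by
    rw [le_div_iff₀ hBn]; linarith
  have hsum : ∑ k ∈ Ico m n, (B (k + 3) - B (k + 2)) / B (k + 3) ≤ ∑ k ∈ Ico m n, 9728 * sh k :=
    Finset.sum_le_sum fun k _ => harvest_increment_le_share h hsh k
  rw [← Finset.mul_sum] at hsum
  linarith

/-- DIVERGENCE OF THE SHARES: the partial sums of `sh` from any start are unbounded. [folklore] -/
theorem harvest_share_unbounded (h : HarvestData a B) {sh : ℕ → ℝ}
    (hsh : ∀ k, sh k = 8 ^ k * a (k + 2) ^ 2 / B (k + 1)) (m : ℕ) (M : ℝ) :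
    ∃ n, m ≤ n ∧ M ≤ ∑ k ∈ Ico m n, sh k := by
  -- N rounds give N/19456
  have hrounds : ∀ N : ℕ, ∃ n, m ≤ n ∧ (N : ℝ) / 19456 ≤ ∑ k ∈ Ico m n, sh k := by
    intro N
    induction N with
    | zero => exact ⟨m, le_rfl, by simp⟩
    | succ N ih =>
        obtain ⟨n, hmn, hn⟩ := ih
        obtain ⟨n', hnn', hn'⟩ := harvest_round h hsh n
        refine ⟨n', by omega, ?_⟩
        rw [← Finset.sum_Ico_consecutive _ hmn hnn'.le]
        push_cast
        linarith
  obtain ⟨N, hN⟩ := exists_nat_ge (19456 * M)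
  obtain ⟨n, hmn, hn⟩ := hrounds N
  refine ⟨n, hmn, le_trans ?_ hn⟩
  rw [le_div_iff₀ (by norm_num : (0:ℝ) < 19456)]
  linarith

/-! ### The ancestor lemma -/

/-- Chaining one-step ratio bounds: if `a(i+t) ≤ C·a(i+t+1)` for `t < n` then `a i ≤ C^n·a(i+n)`
(`C ≥ 0`). [folklore] -/
theorem harvest_chain_le {C : ℝ} (hC : 0 ≤ C) (i : ℕ) :
    ∀ n : ℕ, (∀ t, t < n → a (i + t) ≤ C * a (i + t + 1)) → a i ≤ C ^ n * a (i + n) := by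
  intro n
  induction n with
  | zero => intro _; simp
  | succ n ih =>
      intro hstep
      have h1 := ih fun t ht => hstep t (Nat.lt_succ_of_lt ht)
      have h2 := hstep n (Nat.lt_succ_self n)
      rw [show i + n + 1 = i + (n + 1) by omega] at h2
      calc a i ≤ C ^ n * a (i + n) := h1
        _ ≤ C ^ n * (C * a (i + (n + 1))) := mul_le_mul_of_nonneg_left h2 (pow_nonneg hC _)
        _ = C ^ (n + 1) * a (i + (n + 1)) := by rw [pow_succ]; ring

/-- A big total drop contains a big single drop: if `a(k-4) > 2^128·a(k+4)` (`k ≥ 4`) then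
`a j > 2^16·a(j+1)` for some `j ∈ [k-4, k+3]`. [folklore] -/
theorem harvest_exists_big_step {k : ℕ} (hk : 4 ≤ k)
    (hbig : ¬ a (k - 4) ≤ (2 : ℝ) ^ 128 * a (k + 4)) :
    ∃ j, k - 4 ≤ j ∧ j ≤ k + 3 ∧ (2 : ℝ) ^ 16 * a (j + 1) < a j := by
  by_contra hcon
  push Not at hcon
  apply hbig
  have key := harvest_chain_le (a := a) (C := (2 : ℝ) ^ 16) (by positivity) (k - 4) 8 (fun t ht => by
    have := hcon (k - 4 + t) (by omega) (by omega)
    linarith)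
  rw [show k - 4 + 8 = k + 4 by omega, ← pow_mul] at key
  exact key

/-- Dyadic log-convexity in ratio form: if `a(j+1) ≤ C·a(j+2)` then `a(j+2) ≤ C²·a(j+3)` — the
decay exponent at most doubles from one dyadic scale to the next. [folklore] -/
theorem harvest_ratio_sq (h : HarvestData a B) {C : ℝ} {j : ℕ}
    (hj : a (j + 1) ≤ C * a (j + 2)) : a (j + 2) ≤ C ^ 2 * a (j + 3) := by
  have hlc := h.a_logConvex (j + 1)
  -- a(j+2)^3 ≤ a(j+1)^2 a(j+3) ≤ C^2 a(j+2)^2 a(j+3)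
  have hp2 := h.a_pos (j + 2)
  have hp3 := h.a_pos (j + 3)
  have hp1 := h.a_pos (j + 1)
  have hsq : a (j + 1) ^ 2 ≤ (C * a (j + 2)) ^ 2 := pow_le_pow_left₀ hp1.le hj 2
  have h3 : a (j + 1 + 1) ^ 3 ≤ (C * a (j + 2)) ^ 2 * a (j + 1 + 2) :=
    hlc.trans (mul_le_mul_of_nonneg_right hsq hp3.le)
  rw [show j + 1 + 1 = j + 2 by omega, show j + 1 + 2 = j + 3 by omega] at h3
  -- divide by a(j+2)^2 > 0
  have hsq2 : 0 < a (j + 2) ^ 2 := by positivity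
  have : a (j + 2) * a (j + 2) ^ 2 ≤ (C ^ 2 * a (j + 3)) * a (j + 2) ^ 2 := by nlinarith
  exact le_of_mul_le_mul_right this hsq2

/-- THE ANCESTOR LEMMA: a non-windowed scale `k ≥ 6` (window constant `2^128`) has share at most `1/32`
of the share of some scale `k' ∈ [k-6, k-1]`. [folklore] -/
theorem harvest_ancestor (h : HarvestData a B) {sh : ℕ → ℝ}
    (hsh : ∀ k, sh k = 8 ^ k * a (k + 2) ^ 2 / B (k + 1)) {k : ℕ} (hk : 6 ≤ k)
    (hnw : ¬ a (k - 4) ≤ (2 : ℝ) ^ 128 * a (k + 4)) :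
    ∃ k', k - 6 ≤ k' ∧ k' < k ∧ sh k ≤ (1 / 32) * sh k' := by
  obtain ⟨j, hj1, hj2, hj⟩ := harvest_exists_big_step (a := a) (by omega) hnw
  by_cases hjc : j ≤ k + 1
  · -- the drop is seen by a(k+2) directly; ancestor k' = j - 2
    refine ⟨j - 2, by omega, by omega, ?_⟩
    have hmono : a (k + 2) ≤ a (j + 1) := h.a_anti (by omega)
    have hpos := h.a_pos (k + 2)
    have hposj := h.a_pos j
    have hBk := harvest_B_pos h (k + 1)
    have hBj := harvest_B_pos h (j - 2 + 1)
    have hBmono : B (j - 2 + 1) ≤ B (k + 1) := h.B_mono (by omega)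
    have hj2' : j - 2 + 2 = j := by omega
    rw [hsh k, hsh (j - 2), hj2']
    -- a(k+2)^2 ≤ 2^{-32} a j^2
    have hsq : (2 : ℝ) ^ 32 * a (k + 2) ^ 2 ≤ a j ^ 2 := by
      have h1 : (2 : ℝ) ^ 16 * a (k + 2) ≤ a j := by nlinarith
      have h2 : 0 ≤ (2 : ℝ) ^ 16 * a (k + 2) := by positivity
      nlinarith
    -- 8^k ≤ 8^6 · 8^(j-2)
    have h8 : (8 : ℝ) ^ k ≤ 8 ^ 6 * 8 ^ (j - 2) := by
      rw [← pow_add]; exact pow_le_pow_right₀ (by norm_num) (by omega)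
    rw [div_le_iff₀ hBk]
    calc (8 : ℝ) ^ k * a (k + 2) ^ 2 ≤ (8 ^ 6 * 8 ^ (j - 2)) * (a j ^ 2 / 2 ^ 32) := by
          apply mul_le_mul h8 _ (sq_nonneg _) (by positivity)
          rw [le_div_iff₀ (by positivity)]; linarith
      _ = (1 / 32) * (8 ^ (j - 2) * a j ^ 2 / B (j - 2 + 1)) * (B (j - 2 + 1) / 2 ^ 9) := by
          field_simp; ring
      _ ≤ (1 / 32) * (8 ^ (j - 2) * a j ^ 2 / B (j - 2 + 1)) * B (k + 1) := by
          apply mul_le_mul_of_nonneg_left _ (by positivity)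
          calc B (j - 2 + 1) / 2 ^ 9 ≤ B (j - 2 + 1) := div_le_self hBj.le (by norm_num)
            _ ≤ B (k + 1) := hBmono
  · -- the drop is just above; the ramp constraint forces a(k+1) > 16 a(k+2); ancestor k' = k - 1
    push Not at hjc
    refine ⟨k - 1, by omega, by omega, ?_⟩
    have hdrop : ¬ a (k + 1) ≤ 16 * a (k + 2) := by
      intro hle
      have h2 := harvest_ratio_sq h (j := k) hle
      have h3 := harvest_ratio_sq h (j := k + 1) h2
      norm_num at h2 h3
      rcases (show j = k + 2 ∨ j = k + 3 by omega) with rfl | rfl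
      · have := h.a_pos (k + 3); linarith
      · have := h.a_pos (k + 4)
        rw [show k + 3 + 1 = k + 4 by omega] at hj
        rw [show k + 1 + 3 = k + 4 by omega] at h3
        linarith
    push Not at hdrop
    have hpos := h.a_pos (k + 2)
    have hBk := harvest_B_pos h (k + 1)
    have hBk' := harvest_B_pos h (k - 1 + 1)
    have hBmono : B (k - 1 + 1) ≤ B (k + 1) := h.B_mono (by omega)
    have hk1 : k - 1 + 2 = k + 1 := by omega
    rw [hsh k, hsh (k - 1), hk1, div_le_iff₀ hBk]
    have hsq : 256 * a (k + 2) ^ 2 ≤ a (k + 1) ^ 2 := by nlinarith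
    have h8 : (8 : ℝ) ^ k = 8 * 8 ^ (k - 1) := by
      rw [← pow_succ']; congr 1; omega
    rw [h8]
    calc 8 * (8 : ℝ) ^ (k - 1) * a (k + 2) ^ 2 ≤ 8 * 8 ^ (k - 1) * (a (k + 1) ^ 2 / 256) := by
          apply mul_le_mul_of_nonneg_left _ (by positivity)
          rw [le_div_iff₀ (by norm_num)]; linarith
      _ = (1 / 32) * (8 ^ (k - 1) * a (k + 1) ^ 2 / B (k - 1 + 1)) * B (k - 1 + 1) := by
          field_simp; ring
      _ ≤ (1 / 32) * (8 ^ (k - 1) * a (k + 1) ^ 2 / B (k - 1 + 1)) * B (k + 1) := by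
          apply mul_le_mul_of_nonneg_left hBmono
          exact mul_nonneg (by norm_num) (div_nonneg (mul_nonneg (by positivity) (sq_nonneg _)) hBk'.le)

/-- The ancestor lemma in summed form: for a non-windowed `k ≥ 6`,
`sh k ≤ (1/32)·Σ_{t<6} sh (k-1-t)`. [folklore] -/
theorem harvest_ancestor_sum (h : HarvestData a B) {sh : ℕ → ℝ}
    (hsh : ∀ k, sh k = 8 ^ k * a (k + 2) ^ 2 / B (k + 1)) {k : ℕ} (hk : 6 ≤ k)
    (hnw : ¬ a (k - 4) ≤ (2 : ℝ) ^ 128 * a (k + 4)) :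
    sh k ≤ (1 / 32) * ∑ t ∈ range 6, sh (k - 1 - t) := by
  obtain ⟨k', hk'1, hk'2, hle⟩ := harvest_ancestor h hsh hk hnw
  refine hle.trans (mul_le_mul_of_nonneg_left ?_ (by norm_num))
  have hmem : k - 1 - k' ∈ range 6 := by rw [Finset.mem_range]; omega
  have heq : sh k' = sh (k - 1 - (k - 1 - k')) := by congr 1; omega
  rw [heq]
  exact Finset.single_le_sum (fun t _ => harvest_share_nonneg h hsh _) hmem

/-! ### Divergence of the windowed shares -/

/-- Shifted partial sums are dominated: for `t < 6`, `Σ_{k∈[m+6,n)} sh(k-1-t) ≤ Σ_{k∈[m,n)} sh k`.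
[folklore] -/
theorem harvest_sum_shift_le (h : HarvestData a B) {sh : ℕ → ℝ}
    (hsh : ∀ k, sh k = 8 ^ k * a (k + 2) ^ 2 / B (k + 1)) (m n t : ℕ) (ht : t < 6) :
    ∑ k ∈ Ico (m + 6) n, sh (k - 1 - t) ≤ ∑ k ∈ Ico m n, sh k := by
  have hinj : Set.InjOn (fun k => k - 1 - t) (Ico (m + 6) n : Finset ℕ) := by
    intro x hx y hy hxy
    simp only [Finset.coe_Ico, Set.mem_Ico] at hx hy
    simp only at hxy
    omega
  rw [← Finset.sum_image hinj]
  apply Finset.sum_le_sum_of_subset_of_nonneg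
  · intro x hx
    rw [Finset.mem_image] at hx
    obtain ⟨k, hk, rfl⟩ := hx
    rw [Finset.mem_Ico] at hk ⊢
    omega
  · intro k _ _
    exact harvest_share_nonneg h hsh k

/-- DIVERGENCE OF THE WINDOWED SHARES (window constant `2^128`): from any start `m ≥ 1` the partial sums of
the shares of WINDOWED scales are unbounded.  Proof: non-windowed scales `≥ m+6` contribute at most
`6/32` of everything (ancestor lemma, each scale is an ancestor of at most six later ones), the first six
scales at most `6/7`. [folklore] -/
theorem harvest_windowed_unbounded (h : HarvestData a B) {sh : ℕ → ℝ}
    (hsh : ∀ k, sh k = 8 ^ k * a (k + 2) ^ 2 / B (k + 1)) {m : ℕ} (hm : 1 ≤ m) (M : ℝ) :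
    ∃ n, m ≤ n ∧ M ≤ ∑ k ∈ (Ico m n).filter (fun k => a (k - 4) ≤ (2 : ℝ) ^ 128 * a (k + 4)), sh k := by
  obtain ⟨n, hmn, hn⟩ := harvest_share_unbounded h hsh m (2 * M + 2)
  refine ⟨n, hmn, ?_⟩
  set W : ℕ → Prop := fun k => a (k - 4) ≤ (2 : ℝ) ^ 128 * a (k + 4) with hW
  have hnn := harvest_share_nonneg h hsh
  -- split the full sum into windowed and non-windowed parts
  have hsplit := Finset.sum_filter_add_sum_filter_not (Ico m n) W sh
  -- non-windowed part: first six scales + the rest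
  have hnw : ∑ k ∈ (Ico m n).filter (fun k => ¬ W k), sh k ≤
      6 / 7 + (6 / 32) * ∑ k ∈ Ico m n, sh k := by
    have hsub : (Ico m n).filter (fun k => ¬ W k) ⊆
        (Ico m (m + 6)) ∪ (Ico (m + 6) n).filter (fun k => ¬ W k) := by
      intro k hk
      simp only [Finset.mem_filter, Finset.mem_Ico, Finset.mem_union] at hk ⊢
      by_cases hk6 : k < m + 6
      · left; omega
      · right; exact ⟨⟨by omega, hk.1.2⟩, hk.2⟩
    have hdisj : Disjoint (Ico m (m + 6)) ((Ico (m + 6) n).filter (fun k => ¬ W k)) := by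
      rw [Finset.disjoint_left]
      intro k hk1 hk2
      simp only [Finset.mem_filter, Finset.mem_Ico] at hk1 hk2
      omega
    refine (Finset.sum_le_sum_of_subset_of_nonneg hsub (fun k _ _ => hnn k)).trans ?_
    rw [Finset.sum_union hdisj]
    apply add_le_add
    · -- first six scales: each ≤ 1/7
      calc ∑ k ∈ Ico m (m + 6), sh k ≤ ∑ _k ∈ Ico m (m + 6), (1 / 7 : ℝ) :=
            Finset.sum_le_sum fun k hk => harvest_share_le h hsh (by
              rw [Finset.mem_Ico] at hk; omega)
        _ = 6 / 7 := by simp; norm_num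
    · -- the rest: ancestor lemma, then exchange of sums
      calc ∑ k ∈ (Ico (m + 6) n).filter (fun k => ¬ W k), sh k
          ≤ ∑ k ∈ (Ico (m + 6) n).filter (fun k => ¬ W k), (1 / 32) * ∑ t ∈ range 6, sh (k - 1 - t) := by
            refine Finset.sum_le_sum fun k hk => ?_
            simp only [Finset.mem_filter, Finset.mem_Ico] at hk
            exact harvest_ancestor_sum h hsh (by omega) hk.2
        _ ≤ ∑ k ∈ Ico (m + 6) n, (1 / 32) * ∑ t ∈ range 6, sh (k - 1 - t) := by
            apply Finset.sum_le_sum_of_subset_of_nonneg (Finset.filter_subset _ _)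
            intro k _ _
            exact mul_nonneg (by norm_num) (Finset.sum_nonneg fun t _ => hnn _)
        _ = (1 / 32) * ∑ t ∈ range 6, ∑ k ∈ Ico (m + 6) n, sh (k - 1 - t) := by
            rw [← Finset.mul_sum, Finset.sum_comm]
        _ ≤ (1 / 32) * ∑ _t ∈ range 6, ∑ k ∈ Ico m n, sh k := by
            gcongr with t ht
            exact harvest_sum_shift_le h hsh m n t (Finset.mem_range.1 ht)
        _ = (6 / 32) * ∑ k ∈ Ico m n, sh k := by simp; ring
  have hwin : ∑ k ∈ (Ico m n).filter W, sh k =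
      ∑ k ∈ Ico m n, sh k - ∑ k ∈ (Ico m n).filter (fun k => ¬ W k), sh k := by linarith
  rw [hwin]
  have htot : 0 ≤ ∑ k ∈ Ico m n, sh k := Finset.sum_nonneg fun k _ => hnn k
  by_cases hM : 0 ≤ M
  · nlinarith
  · push Not at hM
    nlinarith

/-- DIVERGENCE OF THE WINDOWED SHARES, self-contained form (registered sub-goal of the crux item; window
constant `2^128`, shares written out). [folklore] -/
theorem harvest_windowedShares_unbounded : ∀ (a B : ℕ → ℝ), HarvestData a B → ∀ (m : ℕ), 1 ≤ m → ∀ M : ℝ, ∃ n : ℕ, m ≤ n ∧ M ≤ ∑ k ∈ (Finset.Ico m n).filter (fun k => a (k - 4) ≤ (2 : ℝ) ^ 128 * a (k + 4)), (8 : ℝ) ^ k * a (k + 2) ^ 2 / B (k + 1) :=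
  fun a B h _ hm M =>
    harvest_windowed_unbounded h (sh := fun k => (8 : ℝ) ^ k * a (k + 2) ^ 2 / B (k + 1)) (fun _ => rfl) hm M

end Summit.CriticalPhenomena.Ising3DConformalLimit.RungOneAdjacentMergingDominantShell

end
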